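import Summits.AtomisticToContinuum.FouriersLaw.Theorems.HiddenChargeMazurOddChargeAlgebraSymbol
import Summits.AtomisticToContinuum.FouriersLaw.Theorems.HiddenChargeMazurOddChargeAlgebraToolkitB
import Summits.AtomisticToContinuum.FouriersLaw.Theorems.HiddenChargeMazurOddChargeAlgebraToolkitC
import Summits.AtomisticToContinuum.FouriersLaw.Theorems.HiddenChargeMazurOddChargeAlgebraSpanZero
import Summits.AtomisticToContinuum.FouriersLaw.Theorems.HiddenChargeMazurOddChargeAlgebraPairHigh
import Summits.AtomisticToContinuum.FouriersLaw.Theorems.HiddenChargeMazurOddChargeAlgebraPairLinear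

/-!
# Odd conservation laws of the pinned anharmonic chain — THEOREM C₊ (the quartic chain)

THEOREM C₊ of the classification behind the negative edge of `HiddenChargeMazur.OddChargeExists`:
a left-aligned (`N f = f`), momentum-odd (`Θ f = -f`), `wt`-homogeneous polynomial `f` of the chain
algebra `𝓡 = ℝ[q_x, p_x : x ∈ ℤ]` with `N (L₊ f) = 0` vanishes (`lam ≠ 0`, `β ≠ 0`), where `L₊` is
the Liouville operator of the homogeneous quartic chain and `N` the left-aligned normal form.

Proof (assembly).  Let `D` be the maximal span of the monomials of `f ≠ 0`.
* `D = 0`: `f ∈ ℝ[q_0, p_0]` and the single-site theorem `cplus_span_zero` applies.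
* `D ≥ 1`: let `d` (odd) be the maximal momentum degree among the span-`D` monomials and
  `F := projSD D d f ≠ 0`, `H := β · projSD (D-1) (d+2) f`.  The symbol calculus of `N ∘ L₊`
  (`projSD_succ_nf_lplus`, `projSD_nf_lplus`) turns `N (L₊ f) = 0` into the leading pair of
  equations `B↑_D F = 0`, `A⁺ F + B↑_{D-1} H = 0`; PAIR-HIGH (`d ≥ 3`) resp. PAIR-LINEAR (`d = 1`,
  after writing `F = Σ_y a_y p_y` by the weighted Euler identity) give `∂_{q_0} F = ∂_{p_0} F = 0`,
  contradicting the fact that every monomial of `F` is left-aligned, i.e. touches site `0`.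
[folklore]
-/

noncomputable section

open MvPolynomial Finsupp
open scoped BigOperators

namespace Summit.AtomisticToContinuum.FouriersLaw.Theorems.OddChargeAlgebra

/-! ## Small tools -/

/-- The boundary operator `B↑_D` commutes with constants. [folklore] -/
private theorem bup_C_mul' (D : ℤ) (c : ℝ) (h : R) : bup D (C c * h) = C c * bup D h := by
  simp only [bup, pderiv_C_mul, map_mul, shift_C]
  ring

/-- `wt = 1 + pwt`: the weight of a monomial is its degree plus its momentum degree. [folklore] -/
private theorem weight_wt_eq' (m : Var →₀ ℕ) :
    weight wt m = weight (1 : Var → ℕ) m + weight pwt m := by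
  simp only [weight_apply, Finsupp.sum, ← Finset.sum_add_distrib]
  refine Finset.sum_congr rfl fun v _ => ?_
  rcases v with x | x
  · simp [wt, pwt]
  · simp [wt, pwt, mul_two]

/-- A polynomial of momentum degree `0` involves no momentum variable. [folklore] -/
private theorem pderiv_inr_eq_zero_of_pwt_zero' {g : R} (hg : IsWeightedHomogeneous pwt g 0)
    (x : ℤ) : pderiv (Sum.inr x) g = 0 := by
  refine (pderiv_eq_zero_iff _ _).mpr fun m hm => ?_
  have h := hg (MvPolynomial.mem_support_iff.mp hm)
  have hle : m (Sum.inr x) ≤ weight pwt m := Finsupp.le_weight pwt (by simp [pwt]) m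
  omega

/-- A `p`-linear polynomial on the sites `[0, D]` is `Σ_y ∂_{p_y} F · p_y` (weighted Euler
identity for the momentum weight). [folklore] -/
private theorem eq_sum_pderiv_mul_X' {D : ℤ} {F : R}
    (hFsupp : F ∈ supported ℝ (Var.site ⁻¹' Set.Icc (0 : ℤ) D))
    (hF1 : IsWeightedHomogeneous pwt F 1) :
    F = ∑ y ∈ Finset.Icc 0 D, pderiv (Sum.inr y) F * X (Sum.inr y) := by
  classical
  have hvars : F.vars ⊆ (Finset.Icc 0 D).image Sum.inl ∪ (Finset.Icc 0 D).image Sum.inr := by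
    intro v hv
    have h := MvPolynomial.mem_supported.mp hFsupp hv
    simp only [Set.mem_preimage, Set.mem_Icc] at h
    rcases v with x | x
    · exact Finset.mem_union_left _ (Finset.mem_image_of_mem _ (Finset.mem_Icc.mpr h))
    · exact Finset.mem_union_right _ (Finset.mem_image_of_mem _ (Finset.mem_Icc.mpr h))
  have hdisj : Disjoint ((Finset.Icc 0 D).image (Sum.inl : ℤ → Var))
      ((Finset.Icc 0 D).image Sum.inr) :=
    Finset.disjoint_left.mpr fun v h1 h2 => by
      obtain ⟨x, -, rfl⟩ := Finset.mem_image.mp h1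
      obtain ⟨y, -, hy⟩ := Finset.mem_image.mp h2
      exact Sum.inr_ne_inl hy
  have e := sum_weight_X_mul_pderiv_of_isWeightedHomogeneous hF1 hvars
  rw [Nat.cast_one, one_mul, Finset.sum_union hdisj,
    Finset.sum_image fun x _ y _ h => Sum.inl_injective h,
    Finset.sum_image fun x _ y _ h => Sum.inr_injective h] at e
  simp only [pwt, Sum.elim_inl, Sum.elim_inr, Nat.cast_zero, zero_mul, Finset.sum_const_zero,
    zero_add, Nat.cast_one, one_mul] at e
  exact e.symm.trans (Finset.sum_congr rfl fun y _ => mul_comm _ _)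

/-! ## The leading pair for odd momentum degree -/

/-- The `p`-linear leading pair (`d = 1`): PAIR-LINEAR in the form of PAIR-HIGH.  Writing
`F = Σ_y a_y p_y` (`a_y = ∂_{p_y} F ∈ ℝ[q_0..q_D]` homogeneous), `pair_linear` gives `a_0 = 0` and
`∂_{q_0} a_y = 0`, i.e. `∂_{p_0} F = 0` and `∂_{q_0} F = 0`. [folklore] -/
private theorem pair_one' {D : ℤ} (hD : 1 ≤ D) {F H : R} {W : ℕ}
    (hFsupp : F ∈ supported ℝ (Var.site ⁻¹' Set.Icc (0 : ℤ) D))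
    (hF1 : IsWeightedHomogeneous pwt F 1) (hFwt : IsWeightedHomogeneous wt F W)
    (hHsupp : H ∈ supported ℝ (Var.site ⁻¹' Set.Icc (0 : ℤ) (D - 1)))
    (hH3 : IsWeightedHomogeneous pwt H 3) (hα : bup D F = 0)
    (hβ : Aplus F + bup (D - 1) H = 0) :
    pderiv (Sum.inl 0) F = 0 ∧ pderiv (Sum.inr 0) F = 0 := by
  obtain ⟨a, ha⟩ : ∃ a : ℤ → R, ∀ y, a y = pderiv (Sum.inr y) F := ⟨_, fun _ => rfl⟩
  have hasupp : ∀ y, a y ∈ supported ℝ (Sum.inl '' Set.Icc (0 : ℤ) D) := fun y => by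
    rw [ha]
    refine mem_supported_of_pderiv_eq_zero fun v hv => ?_
    rcases v with x | x
    · have hx : (Sum.inl x : Var) ∉ Var.site ⁻¹' Set.Icc (0 : ℤ) D := fun h => hv ⟨x, h, rfl⟩
      rw [pderiv_comm, pderiv_eq_zero_of_not_mem_supported hFsupp hx, map_zero]
    · exact pderiv_inr_eq_zero_of_pwt_zero' (hF1.pderiv (by simp [pwt])) x
  have hout : ∀ y, y < 0 ∨ D < y → a y = 0 := fun y hy => by
    rw [ha]
    exact pderiv_eq_zero_of_not_mem_supported hFsupp fun h => by
      simp only [Set.mem_preimage, site_inr, Set.mem_Icc] at h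
      omega
  have hFsum : F = ∑ y ∈ Finset.Icc 0 D, a y * X (Sum.inr y) := by
    simp only [ha]
    exact eq_sum_pderiv_mul_X' hFsupp hF1
  have hFhom : F.IsHomogeneous (W - 1) := fun n hn => by
    have h1 := hFwt hn
    have h2 := hF1 hn
    rw [weight_wt_eq'] at h1
    change weight (1 : Var → ℕ) n = W - 1
    omega
  have hhom : ∀ y, (a y).IsHomogeneous (W - 1 - 1) := fun y => by
    rw [ha]
    exact hFhom.pderiv
  rw [hFsum] at hα hβ
  obtain ⟨ha0, hq⟩ := pair_linear hD a H (W - 1 - 1) hasupp hout hhom hHsupp hH3 hα hβ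
  refine ⟨?_, by rw [← ha]; exact ha0⟩
  rw [hFsum, map_sum]
  refine Finset.sum_eq_zero fun y _ => ?_
  rw [pderiv_mul, hq y, zero_mul, zero_add, pderiv_X_of_ne Sum.inr_ne_inl, mul_zero]

/-- The leading pair for odd momentum degree `d`: `B↑_D F = 0` and `A⁺ F + B↑_{D-1} H = 0` force
`∂_{q_0} F = ∂_{p_0} F = 0` (PAIR-HIGH for `d ≥ 3`, PAIR-LINEAR for `d = 1`). [folklore] -/
private theorem pair_odd' {D : ℤ} (hD : 1 ≤ D) {F H : R} {d W : ℕ} (hd : Odd d)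
    (hFsupp : F ∈ supported ℝ (Var.site ⁻¹' Set.Icc (0 : ℤ) D))
    (hFw : IsWeightedHomogeneous pwt F d) (hFwt : IsWeightedHomogeneous wt F W)
    (hHsupp : H ∈ supported ℝ (Var.site ⁻¹' Set.Icc (0 : ℤ) (D - 1)))
    (hHw : IsWeightedHomogeneous pwt H (d + 2)) (hα : bup D F = 0)
    (hβ : Aplus F + bup (D - 1) H = 0) :
    pderiv (Sum.inl 0) F = 0 ∧ pderiv (Sum.inr 0) F = 0 := by
  obtain ⟨k, rfl⟩ := hd
  rcases Nat.eq_zero_or_pos k with rfl | hk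
  · exact pair_one' hD hFsupp (by simpa using hFw) hFwt hHsupp (by simpa using hHw) hα hβ
  · exact pair_high hD F H (2 * k + 1) (by omega) hFsupp hFw hHsupp hHw hα hβ

/-! ## THEOREM C₊ -/

/-- THEOREM C₊ for maximal span `D ≥ 1`: impossible.  With `d` the (odd) maximal momentum degree
among the span-`D` monomials of the left-aligned `f`, the symbol calculus gives the leading pair of
equations for `F = projSD D d f ∋ m₀` and `H = β · projSD (D-1) (d+2) f`, whence
`∂_{q_0} F = ∂_{p_0} F = 0` — but the left-aligned monomial `m₀` of `F` touches site `0`.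
[folklore] -/
private theorem cplus_pos' {lam β : ℝ} {f : R} {W : ℕ} (hb : β ≠ 0) (hal : nf f = f)
    (hw : IsWeightedHomogeneous wt f W) (hN : nf (lplus lam β f) = 0) {D : ℤ} (hD : 1 ≤ D)
    (hmax : ∀ m ∈ f.support, maxsite m ≤ D) {m₀ : Var →₀ ℕ} (hm₀ : m₀ ∈ f.support)
    (hm₀D : maxsite m₀ = D) (hodd : Odd (weight pwt m₀))
    (hdmax : ∀ m ∈ f.support, maxsite m = D → weight pwt m ≤ weight pwt m₀) : False := by
  obtain ⟨d, hm₀d⟩ : ∃ d, weight pwt m₀ = d := ⟨_, rfl⟩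
  rw [hm₀d] at hodd hdmax
  have h0 : ∀ m ∈ f.support, minsite m = 0 := fun m hm => by
    rcases nf_eq_self_iff.mp hal m hm with rfl | h
    · exact minsite_zero
    · exact h
  -- the leading pair `F = projSD D d f`, `H = β • projSD (D-1) (d+2) f`
  have hFp : ∀ n ∈ (projSD D d f).support, minsite n = 0 ∧ maxsite n = D ∧ weight pwt n = d :=
    fun n hn => (mem_support_projSD_iff.mp hn).2
  have hHp : ∀ n ∈ (projSD (D - 1) (d + 1 + 1) f).support,
      minsite n = 0 ∧ maxsite n = D - 1 ∧ weight pwt n = d + 1 + 1 :=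
    fun n hn => (mem_support_projSD_iff.mp hn).2
  have hFsupp : projSD D d f ∈ supported ℝ (Var.site ⁻¹' Set.Icc (0 : ℤ) D) := by
    have h := mem_supported_of_pure hFp
    rwa [Finset.coe_Icc] at h
  have hHsupp : C β * projSD (D - 1) (d + 1 + 1) f ∈
      supported ℝ (Var.site ⁻¹' Set.Icc (0 : ℤ) (D - 1)) := by
    have h := mem_supported_of_pure hHp
    rw [Finset.coe_Icc] at h
    rw [C_mul']
    exact Subalgebra.smul_mem _ h β
  have hFw : IsWeightedHomogeneous pwt (projSD D d f) d := fun n hn =>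
    (hFp n (MvPolynomial.mem_support_iff.mpr hn)).2.2
  have hFwt : IsWeightedHomogeneous wt (projSD D d f) W := fun n hn =>
    hw (MvPolynomial.mem_support_iff.mp
      (mem_support_projSD_iff.mp (MvPolynomial.mem_support_iff.mpr hn)).1)
  have hHw : IsWeightedHomogeneous pwt (C β * projSD (D - 1) (d + 1 + 1) f) (d + 2) := by
    refine IsWeightedHomogeneous.C_mul (fun n hn => ?_) β
    have h := (hHp n (MvPolynomial.mem_support_iff.mpr hn)).2.2
    omega
  -- `m₀` is a monomial of `F`
  have hm₀0 : m₀ ≠ 0 := by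
    rintro rfl
    rw [map_zero] at hm₀d
    rcases hodd with ⟨k, hk⟩
    omega
  have hm₀F : m₀ ∈ (projSD D d f).support :=
    mem_support_projSD_iff.mpr ⟨hm₀, h0 m₀ hm₀, hm₀D, hm₀d⟩
  have hd1 : 1 ≤ d := by
    rcases hodd with ⟨k, hk⟩
    omega
  -- (α) the class-`(D+1, d-1)` part of `N (L₊ f) = 0`
  have hα : bup D (projSD D d f) = 0 := by
    have h := projSD_succ_nf_lplus lam β f D (d - 1) hD hal hmax
    rw [hN, map_zero, Nat.sub_add_cancel hd1] at h
    rcases mul_eq_zero.mp h.symm with h' | h'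
    · exact absurd ((C_eq_zero (σ := Var)).mp h') hb
    · exact h'
  -- (β) the class-`(D, d+1)` part of `N (L₊ f) = 0`
  have hzero : projSD D (d + 1 + 1) f = 0 := projSD_eq_zero fun m hm hc => by
    have h1 := hdmax m hm hc.2.1
    have h2 := hc.2.2
    omega
  have hβ : Aplus (projSD D d f) + bup (D - 1) (C β * projSD (D - 1) (d + 1 + 1) f) = 0 := by
    have h := projSD_nf_lplus lam β f D (d + 1) hD (by omega) hal hmax hzero
    rw [hN, map_zero, Nat.add_sub_cancel] at h
    rw [bup_C_mul']
    exact h.symm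
  -- the pair lemmas: `F` is free of site `0` — but `m₀` touches site `0`
  obtain ⟨h1, h2⟩ := pair_odd' hD hodd hFsupp hFw hFwt hHsupp hHw hα hβ
  obtain ⟨v, hv, hv0⟩ := exists_site_eq_minsite hm₀0
  rw [h0 m₀ hm₀] at hv0
  have hv' := Finsupp.mem_support_iff.mp hv
  rcases v with x | x
  · rw [site_inl] at hv0
    subst hv0
    exact hv' ((pderiv_eq_zero_iff _ _).mp h1 m₀ hm₀F)
  · rw [site_inr] at hv0
    subst hv0
    exact hv' ((pderiv_eq_zero_iff _ _).mp h2 m₀ hm₀F)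

/-- **THEOREM C₊.**  A left-aligned (`N f = f`), momentum-odd (`Θ f = -f`), `wt`-homogeneous
polynomial density `f` of the homogeneous quartic chain (`lam ≠ 0`, `β ≠ 0`) with `N (L₊ f) = 0`
vanishes: the quartic chain has no momentum-odd polynomial local conservation law in normal
form. [folklore] -/
theorem cplus : ∀ (lam β : ℝ) (f : R) (W : ℕ), lam ≠ 0 → β ≠ 0 → nf f = f → rev f = -f →
    IsWeightedHomogeneous wt f W → nf (lplus lam β f) = 0 → f = 0 := by
  classical
  intro lam β f W hl hb hal hodd hw hN
  by_contra hf
  obtain ⟨m₁, hm₁, hmax⟩ :=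
    Finset.exists_max_image f.support maxsite (MvPolynomial.support_nonempty.mpr hf)
  have h0 : ∀ m ∈ f.support, minsite m = 0 := fun m hm => by
    rcases nf_eq_self_iff.mp hal m hm with rfl | h
    · exact minsite_zero
    · exact h
  rcases lt_or_ge (maxsite m₁) 1 with hD | hD
  · -- maximal span `0`: the single-site theorem
    refine hf (cplus_span_zero lam β f W hl hb ?_ hodd hw hN)
    refine mem_supported_of_site_mem fun m hm v hv => ?_
    have h1 := minsite_le_site hv
    have h2 := site_le_maxsite hv
    have h3 := hmax m hm
    have h4 := h0 m hm
    rw [Set.mem_singleton_iff]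
    omega
  · -- maximal span `D ≥ 1`: the leading pair
    obtain ⟨m₂, hm₂, hdmax⟩ :=
      Finset.exists_max_image (f.support.filter fun m => maxsite m = maxsite m₁)
        (fun m => weight pwt m) ⟨m₁, Finset.mem_filter.mpr ⟨hm₁, rfl⟩⟩
    obtain ⟨hm₂f, hm₂D⟩ := Finset.mem_filter.mp hm₂
    exact cplus_pos' hb hal hw hN hD hmax hm₂f hm₂D (odd_weight_of_rev_eq_neg f hodd m₂ hm₂f)
      fun m hm hmD => hdmax m (Finset.mem_filter.mpr ⟨hm, hmD⟩)

end Summit.AtomisticToContinuum.FouriersLaw.Theorems.OddChargeAlgebra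

end
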